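import Summits.QuantumFields.BalabanUV.Beta.EriceFlowEnclosureB12AsPrintedHistoryContagionShiftFlowZeroTangentSecond
import Summits.QuantumFields.BalabanUV.Beta.EriceFlowEnclosureB12AsPrintedHistoryContagionShiftFlowZeroTangentSecondQuotient

/-!
# Beta / EriceFlowEnclosureB12AsPrintedHistoryContagionShiftFlowZeroTangentSecondFlow — ASYMPTOTIC FREEDOM IS CONTAGIOUS, part 80: THE SECOND-ORDER QUOTIENTS OF THE TANGENT
# FLOW AGAINST THE SECOND TANGENT FLOW, AT EVERY SCALE AT ONCE.  FOR THE FLOW (part 14's package at e′) under the C² SHAPE of part 78 (`hG`, `hGB`, `hH`, `hHB`): W the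
# tangent flow at a pin e, W̃ the tangent flow at a second pin ẽ ≠ e, `δ̂ = 1∕ẽ² − 1∕e²`, V the second tangent flow at e (part 78's derived equation).  Part 79's abstract
# perturbation estimate needs four smallnesses; three are parts 71 and 77 (`|W̃ − W| ≤ η_W`, `|(h̃ − h)∕δ̂ − U| ≤ η_s w`, `|(ṽ − v)∕δ̂ − v′| ≤ η_J w`), the fourth is
# (§142) THE GRADIENT SLOPES AGAINST THE DERIVED COEFFICIENTS: **`|(G(h̃_{p+1+·}) j − G(h_{p+1+·}) j)∕δ̂ − c′_{p,j}| ≤ (8e′³∕(1−θ))·((2∕3)ε + C_Hη_s)·θ^j`** uniformly in p, ε the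
# second-order remainder level of `hHB` at sup-distance `(16∕3)e′³|δ̂| ≤ ρ(ε)` (`(G̃ − G)∕δ̂ − c′ = remainder∕δ̂ + Σ_i H j i·((h̃ − h)_{p+1+i}∕δ̂ − U_{p+1+i})`, both rows charged to
# the AF weights); (§143) the Jacobian increments `|ṽ_q − v_q| ≤ 4e′²|δ̂|·w_q`.  (§144) Feeding part 79: **`|(W̃_k − W_k)∕δ̂ − V_k| ≤ explicit·(ε, η_s, |δ̂|, η_J, η_W)` FOR EVERY
# k**, linear in the five small quantities, and (§145) letting ẽ → e with parts 69, 71, 77: **for every ε₀ > 0, for all ẽ ≠ e close to e, EVERY tangent flow W̃ at ẽ satisfies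
# `|(W̃_k − W_k)∕(1∕ẽ² − 1∕e²) − V_k| ≤ ε₀` FOR EVERY k** — the chart-difference quotients of the tangent flow converge to the second tangent flow UNIFORMLY IN THE SCALE.  Part 81
# reads off the derivatives
# (β-flow team, prover 1, unit `b2b-balaban-beta-bflow-p1`, gen 43; ROW AP-I·Uc × NODE U2)

HONEST FRAMING (page 1 of everything the β sub-cell writes): discharging `BetaPertH` makes Bałaban's UV stability UNCONDITIONAL — a
real constructive-QFT result; it is NOT the continuum limit and NOT the Clay problem.  HONEST DEPENDENCY (cell reorg 2026-08-19,
verbatim): «continuum YM on T⁴ ⇐ BetaPertH ∧ nine spine estimates (0/9 proved); BetaPertH ⇐ (D1) ∧ (D4) ∧ CAP+tail; G-an2-4 gates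
asym, D1 and NE2/3/4.»  THIS MODULE DISCHARGES NOTHING: [folklore] real analysis (geometric rows, part 79's abstract estimate instantiated, filters) over node U2's
HYPOTHESIS SHAPES `T4BetaStationary.{SeqBox, MemoryProfile}`, `T4BetaFlowWellPosed.{MemFlow, solution, seqBox_shift}`, `T4CouplingMatching.{sprof}` and parts 66–69, 71, 77–79
of this series BY NAME (NOT PRINTED for [I] = T. Bałaban, Commun. Math. Phys. **109** (1987) [Balaban1987RG1]: p. 298 says only that β_j depends on the preceding couplings;
(0.20) p. 256; Theorem 2 (0.31) p. 259 STATED WITHOUT PROOF; no derivative of the coupling flow in its datum is printed in [I]).  The C² shape is OUR hypothesis, an explicit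
binder.  Nothing of Bałaban's β is asserted.

WHAT THIS FILE PROVES (0 sorry, 0 def): §142 **`gradientSlope_sub_abs_le`**; §143 `jacobianDiff_abs_le`; §144 **`secondQuotient_sub_secondTangent_abs_le`**;
§145 `mul_div_succ_le`, **`secondQuotient_tendsto_uniform`**.  NOT CLAIMED: the derivatives themselves (part 81); anything about Bałaban's β; `BetaPertH`; the continuum limit of the
measures; Clay.
-/

namespace Summit.QuantumFields.BalabanUV.Beta.EriceFlowEnclosureB12AsPrintedHistoryContagionShiftFlowZeroTangentSecondFlow

open Finset Filter Topology Set
open Literature.MathematicalPhysics.QuantumFieldTheory.Balaban1983to89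
open Literature.MathematicalPhysics.QuantumFieldTheory.Balaban1983to89.T4CouplingMatching (sprof sprof_zero)
open Literature.MathematicalPhysics.QuantumFieldTheory.Balaban1983to89.T4BetaStationary (SeqBox MemoryProfile)
open Literature.MathematicalPhysics.QuantumFieldTheory.Balaban1983to89.T4BetaFlowWellPosed (MemFlow solution seqBox_shift)
open Summit.QuantumFields.BalabanUV.Beta.EriceFlowEnclosureB12AsPrintedHistoryContagionShiftFlowZeroTangent (row_summable_abs_le)
open Summit.QuantumFields.BalabanUV.Beta.EriceFlowEnclosureB12AsPrintedHistoryContagionShiftFlowZeroTangentLimit (profWeight_nonneg profWeight_anti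
  sum_profWeight_le)
open Summit.QuantumFields.BalabanUV.Beta.EriceFlowEnclosureB12AsPrintedHistoryContagionShiftFlowZeroTangentFlow (solution_facts tangent_data smallness_of_hs5)
open Summit.QuantumFields.BalabanUV.Beta.EriceFlowEnclosureB12AsPrintedHistoryContagionShiftFlowZeroTangentDeriv (invSq_sub_ne_zero abs_sub_pins_le_of_quotient
  invSq_sub_invSq_tendsto_zero)
open Summit.QuantumFields.BalabanUV.Beta.EriceFlowEnclosureB12AsPrintedHistoryContagionShiftFlowZeroTangentSmooth (abs_cube_sub_cube_le tangent_continuous_uniform)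
open Summit.QuantumFields.BalabanUV.Beta.EriceFlowEnclosureB12AsPrintedHistoryContagionShiftFlowZeroTangentPin (chartDeriv_facts invSprof_le_two_mul
  chartSlope_tendsto_chartDeriv_uniform jacobianDeriv_abs_le jacobianSlope_tendsto_uniform)
open Summit.QuantumFields.BalabanUV.Beta.EriceFlowEnclosureB12AsPrintedHistoryContagionShiftFlowZeroTangentSecond (gradient_continuity_of_hessian
  derivedCoeff_summable_abs_le)
open Summit.QuantumFields.BalabanUV.Beta.EriceFlowEnclosureB12AsPrintedHistoryContagionShiftFlowZeroTangentSecondQuotient (secondQuotient_sub_abs_le)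

noncomputable section

/-! ## §142 The gradient slopes against the derived coefficients -/

/-- **THE GRADIENT SLOPES AGAINST THE DERIVED COEFFICIENTS, UNIFORMLY IN THE ROW.**  Part 14's package at e′; the Hessian profile `hH`; an (ε, ρ)-instance of the second-order
remainder `hHB`; two pins e ≠ ẽ of ]0, e′] with `(16∕3)e′³|δ̂| ≤ ρ` (so the two histories are ρ-close at every scale, part 69); W the tangent flow at e and an η_s-instance of part
77's chart-slope estimate `|(h̃_q − h_q)∕δ̂ + (h_q³∕2)W_q| ≤ η_s·w_q`.  THEN for every p, j:
**`|(G(h̃_{p+1+·}) j − G(h_{p+1+·}) j)∕δ̂ + Σ_i H(h_{p+1+·}) j i·((h_{p+1+i}³∕2)W_{p+1+i})| ≤ (8e′³∕(1−θ))·((2∕3)ε + C_Hη_s)·θ^j`**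
(`= remainder∕δ̂ + Σ_i H j i·((h̃ − h)_{p+1+i}∕δ̂ + (h³∕2 W)_{p+1+i})`; the remainder row is `≤ εθ^jΣ_iθ^i(2∕3)w_{p+1+i}|δ̂|`, the Hessian row `≤ C_Hθ^jΣ_iθ^iη_sw_{p+1+i}`, both
charged to `w_{p+1} ≤ 8e′³`). [cite: Balaban1987RG1, Thm 2 (0.31) p.259 with (0.20) p.256 and p.298] -/
theorem gradientSlope_sub_abs_le {B : (ℕ → ℝ) → ℝ} {G : (ℕ → ℝ) → ℕ → ℝ} {H : (ℕ → ℝ) → ℕ → ℕ → ℝ} {Cm CH θ γ bs ta gs e' ε ρ ηs : ℝ} {t W : ℕ → ℝ}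
    (hB : MemoryProfile Cm θ γ B) (hCm : 0 ≤ Cm) (hθ0 : 0 ≤ θ) (hθ1 : θ < 1) (hbs : 0 < bs) (hta : 0 < ta)
    (hts : SeqBox γ t) (htf : MemFlow B gs t) (hprof : ∀ m : ℕ, 1 / ta ^ 2 + bs * (m : ℝ) ≤ 1 / (t m) ^ 2)
    (hG : ∀ u : ℕ → ℝ, SeqBox γ u → ∀ j, |G u j| ≤ Cm * θ ^ j) (hCH : 0 ≤ CH)
    (hH : ∀ u : ℕ → ℝ, SeqBox γ u → ∀ j i, |H u j i| ≤ CH * θ ^ j * θ ^ i) (hε : 0 ≤ ε)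
    (hrem2 : ∀ u u' : ℕ → ℝ, SeqBox γ u → SeqBox γ u' → (∀ j, |u' j - u j| ≤ ρ) →
      ∀ j, |G u' j - G u j - ∑' i, H u j i * (u' i - u i)| ≤ ε * θ ^ j * ∑' i, θ ^ i * |u' i - u i|)
    (h2e' : 2 * e' ≤ γ) (hs1 : 4 * Cm * e' ≤ bs * (1 - θ))
    (hs2 : e' ^ 2 * (1 / gs ^ 2 + Cm * γ / (1 - θ) ^ 2 + (2 * Cm / ((1 - θ) * bs)) ^ 2) ≤ 3 / 4)
    (hs4 : 64 * Cm * e' ^ 3 ≤ (1 - θ) ^ 2) (hs5 : Cm * (8 * e' ^ 3 + 16 * e' / bs) ≤ (1 - θ) / 4)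
    {e ee : ℝ} (he : e ∈ Ioc (0 : ℝ) e') (hee : ee ∈ Ioc (0 : ℝ) e') (hne : ee ≠ e) (hρ : 16 / 3 * e' ^ 3 * |1 / ee ^ 2 - 1 / e ^ 2| ≤ ρ)
    (hW : ∀ k, W k = 1 - ∑ p ∈ range k, ∑' j, G (fun i => solution B e (p + 1 + i)) j * ((solution B e (p + 1 + j)) ^ 3 / 2) * W (p + 1 + j))
    (hWM : ∀ k, |W k| ≤ 2) (hηs0 : 0 ≤ ηs)
    (hηs : ∀ q, |(solution B ee q - solution B e q) / (1 / ee ^ 2 - 1 / e ^ 2) + (solution B e q) ^ 3 / 2 * W q|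
      ≤ ηs * (1 / (sprof (2 * e') (bs / 4) q) ^ 2 * (1 / sprof (2 * e') (bs / 4) q))) (p j : ℕ) :
    |(G (fun i => solution B ee (p + 1 + i)) j - G (fun i => solution B e (p + 1 + i)) j) / (1 / ee ^ 2 - 1 / e ^ 2)
        + ∑' i, H (fun l => solution B e (p + 1 + l)) j i * ((solution B e (p + 1 + i)) ^ 3 / 2 * W (p + 1 + i))|
      ≤ 8 * e' ^ 3 / (1 - θ) * (2 / 3 * ε + CH * ηs) * θ ^ j := by
  have he' : 0 < e' := he.1.trans_le he.2
  have h1θ : 0 < 1 - θ := by linarith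
  obtain ⟨hsb, -⟩ := solution_facts hB hCm hθ0 hθ1 hbs hta hts htf hprof h2e' hs1 hs2 hs4 hs5 he
  obtain ⟨hsbb, -⟩ := solution_facts hB hCm hθ0 hθ1 hbs hta hts htf hprof h2e' hs1 hs2 hs4 hs5 hee
  have hU := fun q => (chartDeriv_facts hB hCm hθ0 hθ1 hbs hta hts htf hprof hG h2e' hs1 hs2 hs4 hs5 he hW hWM q).2.2
  have hΔ := fun q => abs_sub_pins_le_of_quotient hB hCm hθ0 hθ1 hbs hta hts htf hprof h2e' hs1 hs2 hs4 hs5 he hee hne q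
  set δ : ℝ := 1 / ee ^ 2 - 1 / e ^ 2 with hδ
  have hδne : δ ≠ 0 := invSq_sub_ne_zero he.1 hee.1 hne
  have hδ0 : 0 < |δ| := abs_pos.mpr hδne
  set u : ℕ → ℝ := fun i => solution B e (p + 1 + i) with hu
  set uu : ℕ → ℝ := fun i => solution B ee (p + 1 + i) with huu
  set a : ℕ → ℝ := fun i => (solution B e (p + 1 + i)) ^ 3 / 2 * W (p + 1 + i) with ha
  set w : ℕ → ℝ := fun q => 1 / (sprof (2 * e') (bs / 4) q) ^ 2 * (1 / sprof (2 * e') (bs / 4) q) with hw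
  have hus : SeqBox γ u := seqBox_shift hsb (p + 1)
  have huus : SeqBox γ uu := seqBox_shift hsbb (p + 1)
  have hwanti : ∀ {a b : ℕ}, a ≤ b → w b ≤ w a := fun hab => profWeight_anti hbs he' hab
  have hθj : 0 ≤ θ ^ j := pow_nonneg hθ0 j
  have hw8 : w (p + 1) ≤ 8 * e' ^ 3 := by
    have h := profWeight_anti hbs he' (Nat.zero_le (p + 1))
    rw [sprof_zero (by positivity : (0:ℝ) < 2 * e')] at h
    have e8 : 1 / (1 / (2 * e')) ^ 2 * (1 / (1 / (2 * e'))) = 8 * e' ^ 3 := by field_simp; ring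
    rw [e8] at h
    exact h
  have hw0 : 0 ≤ w (p + 1) := profWeight_nonneg hbs he' (p + 1)
  -- the two histories are ρ-close and their increments are weighted
  have hd : ∀ i, |uu i - u i| ≤ ρ := fun i => (hΔ (p + 1 + i)).2.trans hρ
  have hdw : ∀ i, |(θ ^ i * |uu i - u i|)| ≤ 1 * θ ^ i * (w (p + 1 + i) * (2 / 3 * |δ|)) := fun i => by
    rw [abs_of_nonneg (mul_nonneg (pow_nonneg hθ0 i) (abs_nonneg _)), one_mul]
    refine mul_le_mul_of_nonneg_left ?_ (pow_nonneg hθ0 i)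
    have := (hΔ (p + 1 + i)).1
    simp only [hw]; linarith
  obtain ⟨hsΔ, hTle⟩ := row_summable_abs_le hθ0 hθ1 hwanti (by positivity : 0 ≤ 2 / 3 * |δ|) zero_le_one p hdw
  -- the Hessian rows
  have hFΔ : ∀ i, |H u j i * (uu i - u i)| ≤ (CH * θ ^ j) * θ ^ i * (w (p + 1 + i) * (2 / 3 * |δ|)) := fun i => by
    rw [abs_mul]
    have := (hΔ (p + 1 + i)).1
    calc |H u j i| * |uu i - u i| ≤ CH * θ ^ j * θ ^ i * (2 / 3 * w (p + 1 + i) * |δ|) :=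
          mul_le_mul (hH u hus j i) this (abs_nonneg _) (by positivity)
      _ = (CH * θ ^ j) * θ ^ i * (w (p + 1 + i) * (2 / 3 * |δ|)) := by ring
  obtain ⟨hsHΔ, -⟩ := row_summable_abs_le hθ0 hθ1 hwanti (by positivity : 0 ≤ 2 / 3 * |δ|) (by positivity : 0 ≤ CH * θ ^ j) p hFΔ
  have hFa : ∀ i, |H u j i * ((uu i - u i) / δ + a i)| ≤ (CH * θ ^ j) * θ ^ i * (w (p + 1 + i) * ηs) := fun i => by
    rw [abs_mul]
    calc |H u j i| * |(uu i - u i) / δ + a i| ≤ CH * θ ^ j * θ ^ i * (ηs * w (p + 1 + i)) :=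
          mul_le_mul (hH u hus j i) (hηs (p + 1 + i)) (abs_nonneg _) (by positivity)
      _ = (CH * θ ^ j) * θ ^ i * (w (p + 1 + i) * ηs) := by ring
  obtain ⟨hsHa, hHale⟩ := row_summable_abs_le hθ0 hθ1 hwanti hηs0 (by positivity : 0 ≤ CH * θ ^ j) p hFa
  have hsA : Summable fun i => H u j i * a i := by
    have h := hsHa.sub (hsHΔ.div_const δ)
    refine h.congr fun i => ?_
    ring
  -- the identity
  have hid : (G uu j - G u j) / δ + ∑' i, H u j i * a i
      = (G uu j - G u j - ∑' i, H u j i * (uu i - u i)) / δ + ∑' i, H u j i * ((uu i - u i) / δ + a i) := by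
    have h1 : ∑' i, H u j i * ((uu i - u i) / δ + a i) = (∑' i, H u j i * (uu i - u i)) / δ + ∑' i, H u j i * a i := by
      rw [← tsum_div_const, ← (hsHΔ.div_const δ).tsum_add hsA]
      exact tsum_congr fun i => by ring
    rw [h1]; ring
  rw [hid]
  have hR := hrem2 u uu hus huus hd j
  have h1 : |(G uu j - G u j - ∑' i, H u j i * (uu i - u i)) / δ| ≤ ε * θ ^ j * (2 / 3 * w (p + 1)) / (1 - θ) := by
    rw [abs_div, div_le_iff₀ hδ0]
    calc |G uu j - G u j - ∑' i, H u j i * (uu i - u i)| ≤ ε * θ ^ j * ∑' i, θ ^ i * |uu i - u i| := hR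
      _ ≤ ε * θ ^ j * (1 * (w (p + 1) * (2 / 3 * |δ|)) / (1 - θ)) := by
          refine mul_le_mul_of_nonneg_left ?_ (by positivity)
          have h := hTle
          rwa [abs_of_nonneg (tsum_nonneg fun i => mul_nonneg (pow_nonneg hθ0 i) (abs_nonneg _))] at h
      _ = ε * θ ^ j * (2 / 3 * w (p + 1)) / (1 - θ) * |δ| := by ring
  calc |(G uu j - G u j - ∑' i, H u j i * (uu i - u i)) / δ + ∑' i, H u j i * ((uu i - u i) / δ + a i)|
      ≤ |(G uu j - G u j - ∑' i, H u j i * (uu i - u i)) / δ| + |∑' i, H u j i * ((uu i - u i) / δ + a i)| := abs_add_le _ _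
    _ ≤ ε * θ ^ j * (2 / 3 * w (p + 1)) / (1 - θ) + CH * θ ^ j * (w (p + 1) * ηs) / (1 - θ) := add_le_add h1 hHale
    _ = (2 / 3 * ε + CH * ηs) * θ ^ j * w (p + 1) / (1 - θ) := by ring
    _ ≤ (2 / 3 * ε + CH * ηs) * θ ^ j * (8 * e' ^ 3) / (1 - θ) :=
        div_le_div_of_nonneg_right (mul_le_mul_of_nonneg_left hw8 (by positivity)) h1θ.le
    _ = 8 * e' ^ 3 / (1 - θ) * (2 / 3 * ε + CH * ηs) * θ ^ j := by ring

/-! ## §143 The Jacobian increments are weighted -/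

/-- **`|h̃_q³∕2 − h_q³∕2| ≤ 4e′²·|δ̂|·w_q`** at every scale for two pins e ≠ ẽ of ]0, e′] (part 71's cube lemma with part 69's weighted coupling separation and `σ_q² ≤ 4e′²`).
[cite: Balaban1987RG1, Thm 2 (0.31) p.259 with (0.20) p.256 and p.298] -/
theorem jacobianDiff_abs_le {B : (ℕ → ℝ) → ℝ} {Cm θ γ bs ta gs e' : ℝ} {t : ℕ → ℝ}
    (hB : MemoryProfile Cm θ γ B) (hCm : 0 ≤ Cm) (hθ0 : 0 ≤ θ) (hθ1 : θ < 1) (hbs : 0 < bs) (hta : 0 < ta)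
    (hts : SeqBox γ t) (htf : MemFlow B gs t) (hprof : ∀ m : ℕ, 1 / ta ^ 2 + bs * (m : ℝ) ≤ 1 / (t m) ^ 2)
    (h2e' : 2 * e' ≤ γ) (hs1 : 4 * Cm * e' ≤ bs * (1 - θ))
    (hs2 : e' ^ 2 * (1 / gs ^ 2 + Cm * γ / (1 - θ) ^ 2 + (2 * Cm / ((1 - θ) * bs)) ^ 2) ≤ 3 / 4)
    (hs4 : 64 * Cm * e' ^ 3 ≤ (1 - θ) ^ 2) (hs5 : Cm * (8 * e' ^ 3 + 16 * e' / bs) ≤ (1 - θ) / 4)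
    {e ee : ℝ} (he : e ∈ Ioc (0 : ℝ) e') (hee : ee ∈ Ioc (0 : ℝ) e') (hne : ee ≠ e) (q : ℕ) :
    |(solution B ee q) ^ 3 / 2 - (solution B e q) ^ 3 / 2|
      ≤ 4 * e' ^ 2 * |1 / ee ^ 2 - 1 / e ^ 2| * (1 / (sprof (2 * e') (bs / 4) q) ^ 2 * (1 / sprof (2 * e') (bs / 4) q)) := by
  have he' : 0 < e' := he.1.trans_le he.2
  obtain ⟨hsb, -, -, hle, -, -⟩ := solution_facts hB hCm hθ0 hθ1 hbs hta hts htf hprof h2e' hs1 hs2 hs4 hs5 he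
  obtain ⟨hsbb, -, -, hlee, -, -⟩ := solution_facts hB hCm hθ0 hθ1 hbs hta hts htf hprof h2e' hs1 hs2 hs4 hs5 hee
  obtain ⟨hba, -⟩ := abs_sub_pins_le_of_quotient hB hCm hθ0 hθ1 hbs hta hts htf hprof h2e' hs1 hs2 hs4 hs5 he hee hne q
  obtain ⟨-, hσ2, -⟩ := invSprof_le_two_mul hbs he' q
  have hw0 := profWeight_nonneg hbs he' q
  have hcube := abs_cube_sub_cube_le (hsb q).1 (hsbb q).1 (hle q) (hlee q)
  calc _ ≤ 3 / 2 * (1 / sprof (2 * e') (bs / 4) q) ^ 2 * |solution B ee q - solution B e q| := hcube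
    _ ≤ 3 / 2 * (4 * e' ^ 2) * (2 / 3 * (1 / (sprof (2 * e') (bs / 4) q) ^ 2 * (1 / sprof (2 * e') (bs / 4) q)) * |1 / ee ^ 2 - 1 / e ^ 2|) :=
        mul_le_mul (mul_le_mul_of_nonneg_left hσ2 (by norm_num)) hba (abs_nonneg _) (by positivity)
    _ = 4 * e' ^ 2 * |1 / ee ^ 2 - 1 / e ^ 2| * (1 / (sprof (2 * e') (bs / 4) q) ^ 2 * (1 / sprof (2 * e') (bs / 4) q)) := by ring

/-! ## §144 The second-order quotients against the second tangent flow: the explicit estimate -/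

/-- **THE SECOND-ORDER QUOTIENTS AGAINST THE SECOND TANGENT FLOW, AT EVERY SCALE AT ONCE (explicit form).**  Part 14's package at e′; `hG`, the Hessian profile `hH`, an
(ε, ρ)-instance of `hHB`; two pins e ≠ ẽ of ]0, e′] with `(16∕3)e′³|δ̂| ≤ ρ`; W, W̃ the tangent flows at e, ẽ; V a bounded solution of part 78's derived equation at e; instances
η_s (part 77's chart slopes), η_J (part 77's Jacobian slopes), η_W (`|W̃_q − W_q| ≤ η_W`, part 71).  THEN for EVERY k, `|(W̃_k − W_k)∕δ̂ − V_k|` is below part 79's bound with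
`M′ = 2`, `C₁ = 8C_He′³∕(1−θ)`, `D₁ = 6e′²`, `η_c = (8e′³∕(1−θ))((2∕3)ε + C_Hη_s)` (§142), `η_d = 4e′²|δ̂|` (§143), `η_v = η_J` — LINEAR in the five small quantities
`ε, η_s, |δ̂|, η_J, η_W`. [cite: Balaban1987RG1, Thm 2 (0.31) p.259 with (0.20) p.256 and p.298] -/
theorem secondQuotient_sub_secondTangent_abs_le {B : (ℕ → ℝ) → ℝ} {G : (ℕ → ℝ) → ℕ → ℝ} {H : (ℕ → ℝ) → ℕ → ℕ → ℝ}
    {Cm CH θ γ bs ta gs e' ε ρ ηs ηJ ηW MV : ℝ} {t W WW V : ℕ → ℝ}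
    (hB : MemoryProfile Cm θ γ B) (hCm : 0 ≤ Cm) (hθ0 : 0 ≤ θ) (hθ1 : θ < 1) (hbs : 0 < bs) (hta : 0 < ta)
    (hts : SeqBox γ t) (htf : MemFlow B gs t) (hprof : ∀ m : ℕ, 1 / ta ^ 2 + bs * (m : ℝ) ≤ 1 / (t m) ^ 2)
    (hG : ∀ u : ℕ → ℝ, SeqBox γ u → ∀ j, |G u j| ≤ Cm * θ ^ j) (hCH : 0 ≤ CH)
    (hH : ∀ u : ℕ → ℝ, SeqBox γ u → ∀ j i, |H u j i| ≤ CH * θ ^ j * θ ^ i) (hε : 0 ≤ ε)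
    (hrem2 : ∀ u u' : ℕ → ℝ, SeqBox γ u → SeqBox γ u' → (∀ j, |u' j - u j| ≤ ρ) →
      ∀ j, |G u' j - G u j - ∑' i, H u j i * (u' i - u i)| ≤ ε * θ ^ j * ∑' i, θ ^ i * |u' i - u i|)
    (h2e' : 2 * e' ≤ γ) (hs1 : 4 * Cm * e' ≤ bs * (1 - θ))
    (hs2 : e' ^ 2 * (1 / gs ^ 2 + Cm * γ / (1 - θ) ^ 2 + (2 * Cm / ((1 - θ) * bs)) ^ 2) ≤ 3 / 4)
    (hs4 : 64 * Cm * e' ^ 3 ≤ (1 - θ) ^ 2) (hs5 : Cm * (8 * e' ^ 3 + 16 * e' / bs) ≤ (1 - θ) / 4)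
    {e ee : ℝ} (he : e ∈ Ioc (0 : ℝ) e') (hee : ee ∈ Ioc (0 : ℝ) e') (hne : ee ≠ e) (hρ : 16 / 3 * e' ^ 3 * |1 / ee ^ 2 - 1 / e ^ 2| ≤ ρ)
    (hW : ∀ k, W k = 1 - ∑ p ∈ range k, ∑' j, G (fun i => solution B e (p + 1 + i)) j * ((solution B e (p + 1 + j)) ^ 3 / 2) * W (p + 1 + j))
    (hWM : ∀ k, |W k| ≤ 2)
    (hWW : ∀ k, WW k = 1 - ∑ p ∈ range k, ∑' j, G (fun i => solution B ee (p + 1 + i)) j * ((solution B ee (p + 1 + j)) ^ 3 / 2) * WW (p + 1 + j))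
    (hWWM : ∀ k, |WW k| ≤ 2)
    (hV : ∀ k, V k = (-∑ p ∈ range k, ∑' j,
        ((-∑' i, H (fun l => solution B e (p + 1 + l)) j i * ((solution B e (p + 1 + i)) ^ 3 / 2 * W (p + 1 + i))) * ((solution B e (p + 1 + j)) ^ 3 / 2)
          + G (fun i => solution B e (p + 1 + i)) j * (-(3 / 4 * (solution B e (p + 1 + j)) ^ 5 * W (p + 1 + j)))) * W (p + 1 + j))
      - ∑ p ∈ range k, ∑' j, G (fun i => solution B e (p + 1 + i)) j * ((solution B e (p + 1 + j)) ^ 3 / 2) * V (p + 1 + j))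
    (hVM : ∀ k, |V k| ≤ MV) (hηs0 : 0 ≤ ηs)
    (hηs : ∀ q, |(solution B ee q - solution B e q) / (1 / ee ^ 2 - 1 / e ^ 2) + (solution B e q) ^ 3 / 2 * W q|
      ≤ ηs * (1 / (sprof (2 * e') (bs / 4) q) ^ 2 * (1 / sprof (2 * e') (bs / 4) q))) (hηJ0 : 0 ≤ ηJ)
    (hηJ : ∀ q, |((solution B ee q) ^ 3 / 2 - (solution B e q) ^ 3 / 2) / (1 / ee ^ 2 - 1 / e ^ 2) + 3 / 4 * (solution B e q) ^ 5 * W q|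
      ≤ ηJ * (1 / (sprof (2 * e') (bs / 4) q) ^ 2 * (1 / sprof (2 * e') (bs / 4) q))) (hηW0 : 0 ≤ ηW) (hηW : ∀ q, |WW q - W q| ≤ ηW) (k : ℕ) :
    |(WW k - W k) / (1 / ee ^ 2 - 1 / e ^ 2) - V k|
      ≤ ((((8 * e' ^ 3 / (1 - θ) * (2 / 3 * ε + CH * ηs)) / 2 + (8 * CH * e' ^ 3 / (1 - θ)) * (4 * e' ^ 2 * |1 / ee ^ 2 - 1 / e ^ 2|) + Cm * ηJ) * 2
            + ((8 * CH * e' ^ 3 / (1 - θ)) / 2 + Cm * (6 * e' ^ 2)) * ηW) * (8 * e' ^ 3 + 16 * e' / bs) * 1 / (1 - θ))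
        / (1 - Cm * (8 * e' ^ 3 + 16 * e' / bs) / (2 * (1 - θ))) := by
  have he' : 0 < e' := he.1.trans_le he.2
  have h1θ : 0 < 1 - θ := by linarith
  obtain ⟨hsb, -, -, -, -, hcube⟩ := solution_facts hB hCm hθ0 hθ1 hbs hta hts htf hprof h2e' hs1 hs2 hs4 hs5 he
  obtain ⟨hsbb, -, -, -, -, hcubeb⟩ := solution_facts hB hCm hθ0 hθ1 hbs hta hts htf hprof h2e' hs1 hs2 hs4 hs5 hee
  obtain ⟨hc, hv⟩ := tangent_data (B := B) (e' := e') hG hsb hcube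
  obtain ⟨hcc, hvv⟩ := tangent_data (B := B) (e' := e') hG hsbb hcubeb
  obtain ⟨-, hq, -⟩ := smallness_of_hs5 (Cm := Cm) (bs := bs) (e' := e') hθ1 hs5
  -- derived data bounds
  have hc₁ : ∀ p j, |-∑' i, H (fun l => solution B e (p + 1 + l)) j i * ((solution B e (p + 1 + i)) ^ 3 / 2 * W (p + 1 + i))|
      ≤ 8 * CH * e' ^ 3 / (1 - θ) * θ ^ j := fun p j => by
    rw [abs_neg]
    exact (derivedCoeff_summable_abs_le hB hCm hθ0 hθ1 hbs hta hts htf hprof hG hCH hH h2e' hs1 hs2 hs4 hs5 he hW hWM p j).2.2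
  have hv₁ : ∀ q, |-(3 / 4 * (solution B e q) ^ 5 * W q)| ≤ 6 * e' ^ 2 * (1 / (sprof (2 * e') (bs / 4) q) ^ 2 * (1 / sprof (2 * e') (bs / 4) q)) :=
    fun q => by
    rw [abs_neg]
    exact (jacobianDeriv_abs_le hB hCm hθ0 hθ1 hbs hta hts htf hprof hG h2e' hs1 hs2 hs4 hs5 he hW hWM q).2
  -- the four smallnesses
  have hηc : ∀ p j, |(G (fun i => solution B ee (p + 1 + i)) j - G (fun i => solution B e (p + 1 + i)) j) / (1 / ee ^ 2 - 1 / e ^ 2)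
      - -∑' i, H (fun l => solution B e (p + 1 + l)) j i * ((solution B e (p + 1 + i)) ^ 3 / 2 * W (p + 1 + i))|
      ≤ 8 * e' ^ 3 / (1 - θ) * (2 / 3 * ε + CH * ηs) * θ ^ j := fun p j => by
    rw [sub_neg_eq_add]
    exact gradientSlope_sub_abs_le hB hCm hθ0 hθ1 hbs hta hts htf hprof hG hCH hH hε hrem2 h2e' hs1 hs2 hs4 hs5 he hee hne hρ hW hWM hηs0 hηs p j
  have hηd : ∀ q, |(solution B ee q) ^ 3 / 2 - (solution B e q) ^ 3 / 2|
      ≤ 4 * e' ^ 2 * |1 / ee ^ 2 - 1 / e ^ 2| * (1 / (sprof (2 * e') (bs / 4) q) ^ 2 * (1 / sprof (2 * e') (bs / 4) q)) :=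
    jacobianDiff_abs_le hB hCm hθ0 hθ1 hbs hta hts htf hprof h2e' hs1 hs2 hs4 hs5 he hee hne
  have hηv : ∀ q, |((solution B ee q) ^ 3 / 2 - (solution B e q) ^ 3 / 2) / (1 / ee ^ 2 - 1 / e ^ 2) - -(3 / 4 * (solution B e q) ^ 5 * W q)|
      ≤ ηJ * (1 / (sprof (2 * e') (bs / 4) q) ^ 2 * (1 / sprof (2 * e') (bs / 4) q)) := fun q => by
    rw [sub_neg_eq_add]; exact hηJ q
  exact secondQuotient_sub_abs_le (s := fun _ => (1 : ℝ)) hCm (by positivity : 0 ≤ 8 * CH * e' ^ 3 / (1 - θ)) (by positivity : (0:ℝ) ≤ 6 * e' ^ 2)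
    hθ0 hθ1 (profWeight_nonneg hbs he') (fun hab => profWeight_anti hbs he' hab) (sum_profWeight_le hbs he') hq zero_le_two
    hc hv hcc hvv hc₁ hv₁ hW hWM hWW hWWM hV hVM (by positivity) hηc (by positivity) hηd hηJ0 hηv hηW0 hηW k

/-! ## §145 The limit ẽ → e: the second-order quotients converge to the second tangent flow, uniformly in the scale -/

/-- `M ≥ 0`, `ε₀ ≥ 0` ⟹ `M·(ε₀∕(M + 1)) ≤ ε₀`. [folklore] -/
theorem mul_div_succ_le {M ε₀ : ℝ} (hM : 0 ≤ M) (hε₀ : 0 ≤ ε₀) : M * (ε₀ / (M + 1)) ≤ ε₀ := by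
  rw [← mul_div_assoc, div_le_iff₀ (by positivity)]
  nlinarith

/-- **THE SECOND-ORDER QUOTIENTS OF THE TANGENT FLOW CONVERGE TO THE SECOND TANGENT FLOW, UNIFORMLY IN THE SCALE.**  Part 14's package at e′; the C² shape (`hG`, `hGB`, `hH`,
`hHB`); an INTERIOR pin `e ∈ ]0, e′[`; W the tangent flow at e; V a bounded solution of part 78's derived equation at e.  THEN for every ε₀ > 0, for all ẽ ≠ e close enough to
e: ẽ ∈ ]0, e′] and EVERY tangent flow W̃ at ẽ (its equation + `|W̃| ≤ 2`) satisfies **`|(W̃_k − W_k)∕(1∕ẽ² − 1∕e²) − V_k| ≤ ε₀` FOR EVERY k** (§144 with the five small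
quantities supplied by `hHB`, part 77's chart and Jacobian slopes, the chart increment → 0, and part 71's continuity of the tangent flow in the pin — the letter `hGc` it needs is
part 78's `gradient_continuity_of_hessian`). [cite: Balaban1987RG1, Thm 2 (0.31) p.259 with (0.20) p.256 and p.298] -/
theorem secondQuotient_tendsto_uniform {B : (ℕ → ℝ) → ℝ} {G : (ℕ → ℝ) → ℕ → ℝ} {H : (ℕ → ℝ) → ℕ → ℕ → ℝ} {Cm CH θ γ bs ta gs e' MV : ℝ} {t W V : ℕ → ℝ}
    (hB : MemoryProfile Cm θ γ B) (hCm : 0 ≤ Cm) (hθ0 : 0 ≤ θ) (hθ1 : θ < 1) (hbs : 0 < bs) (hta : 0 < ta)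
    (hts : SeqBox γ t) (htf : MemFlow B gs t) (hprof : ∀ m : ℕ, 1 / ta ^ 2 + bs * (m : ℝ) ≤ 1 / (t m) ^ 2)
    (hG : ∀ u : ℕ → ℝ, SeqBox γ u → ∀ j, |G u j| ≤ Cm * θ ^ j)
    (hGB : ∀ ε > 0, ∃ ρ > 0, ∀ u u' : ℕ → ℝ, SeqBox γ u → SeqBox γ u' → (∀ j, |u' j - u j| ≤ ρ) →
      |B u' - B u - ∑' j, G u j * (u' j - u j)| ≤ ε * ∑' j, θ ^ j * |u' j - u j|) (hCH : 0 ≤ CH)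
    (hH : ∀ u : ℕ → ℝ, SeqBox γ u → ∀ j i, |H u j i| ≤ CH * θ ^ j * θ ^ i)
    (hHB : ∀ ε > 0, ∃ ρ > 0, ∀ u u' : ℕ → ℝ, SeqBox γ u → SeqBox γ u' → (∀ j, |u' j - u j| ≤ ρ) →
      ∀ j, |G u' j - G u j - ∑' i, H u j i * (u' i - u i)| ≤ ε * θ ^ j * ∑' i, θ ^ i * |u' i - u i|)
    (h2e' : 2 * e' ≤ γ) (hs1 : 4 * Cm * e' ≤ bs * (1 - θ))
    (hs2 : e' ^ 2 * (1 / gs ^ 2 + Cm * γ / (1 - θ) ^ 2 + (2 * Cm / ((1 - θ) * bs)) ^ 2) ≤ 3 / 4)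
    (hs4 : 64 * Cm * e' ^ 3 ≤ (1 - θ) ^ 2) (hs5 : Cm * (8 * e' ^ 3 + 16 * e' / bs) ≤ (1 - θ) / 4) {e : ℝ} (he : e ∈ Ioo (0 : ℝ) e')
    (hW : ∀ k, W k = 1 - ∑ p ∈ range k, ∑' j, G (fun i => solution B e (p + 1 + i)) j * ((solution B e (p + 1 + j)) ^ 3 / 2) * W (p + 1 + j))
    (hWM : ∀ k, |W k| ≤ 2)
    (hV : ∀ k, V k = (-∑ p ∈ range k, ∑' j,
        ((-∑' i, H (fun l => solution B e (p + 1 + l)) j i * ((solution B e (p + 1 + i)) ^ 3 / 2 * W (p + 1 + i))) * ((solution B e (p + 1 + j)) ^ 3 / 2)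
          + G (fun i => solution B e (p + 1 + i)) j * (-(3 / 4 * (solution B e (p + 1 + j)) ^ 5 * W (p + 1 + j)))) * W (p + 1 + j))
      - ∑ p ∈ range k, ∑' j, G (fun i => solution B e (p + 1 + i)) j * ((solution B e (p + 1 + j)) ^ 3 / 2) * V (p + 1 + j))
    (hVM : ∀ k, |V k| ≤ MV) {ε₀ : ℝ} (hε₀ : 0 < ε₀) :
    ∀ᶠ ee in 𝓝[≠] e, ee ∈ Ioc (0 : ℝ) e' ∧ ∀ WW : ℕ → ℝ,
      (∀ k, WW k = 1 - ∑ p ∈ range k, ∑' j, G (fun i => solution B ee (p + 1 + i)) j * ((solution B ee (p + 1 + j)) ^ 3 / 2) * WW (p + 1 + j)) →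
      (∀ k, |WW k| ≤ 2) → ∀ k, |(WW k - W k) / (1 / ee ^ 2 - 1 / e ^ 2) - V k| ≤ ε₀ := by
  have he' : 0 < e' := he.1.trans he.2
  have h1θ : 0 < 1 - θ := by linarith
  have hec : e ∈ Ioc (0 : ℝ) e' := ⟨he.1, he.2.le⟩
  obtain ⟨-, hq, -⟩ := smallness_of_hs5 (Cm := Cm) (bs := bs) (e' := e') hθ1 hs5
  -- the constants of §144: the bound is L·(a₁ε + a₂η_s + a₃|δ̂| + a₄η_J + a₅η_W)
  obtain ⟨L, hL⟩ : ∃ L : ℝ, L = (8 * e' ^ 3 + 16 * e' / bs) * 1 / (1 - θ) / (1 - Cm * (8 * e' ^ 3 + 16 * e' / bs) / (2 * (1 - θ))) := ⟨_, rfl⟩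
  have hL0 : 0 ≤ L := by
    rw [hL]; exact div_nonneg (by positivity) (by linarith)
  obtain ⟨M, hM⟩ : ∃ M : ℝ, M = L * (8 * e' ^ 3 / (1 - θ) * (2 / 3) + 8 * e' ^ 3 / (1 - θ) * CH + 2 * (8 * CH * e' ^ 3 / (1 - θ)) * (4 * e' ^ 2)
      + 2 * Cm + ((8 * CH * e' ^ 3 / (1 - θ)) / 2 + Cm * (6 * e' ^ 2))) := ⟨_, rfl⟩
  have hM0 : 0 ≤ M := by rw [hM]; positivity
  -- one small quantity τ for all five
  obtain ⟨τ, hτ⟩ : ∃ τ : ℝ, τ = ε₀ / (M + 1) := ⟨_, rfl⟩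
  have hτ0 : 0 < τ := by rw [hτ]; positivity
  obtain ⟨ρ, hρ, hrem2⟩ := hHB τ hτ0
  have hslope := chartSlope_tendsto_chartDeriv_uniform hB hCm hθ0 hθ1 hbs hta hts htf hprof hG hGB h2e' hs1 hs2 hs4 hs5 he hW hWM hτ0
  have hjac := jacobianSlope_tendsto_uniform hB hCm hθ0 hθ1 hbs hta hts htf hprof hG hGB h2e' hs1 hs2 hs4 hs5 he hW hWM hτ0
  have hGc := gradient_continuity_of_hessian (γ := γ) hCH hθ0 hθ1 hH hHB
  have hcont := tangent_continuous_uniform hB hCm hθ0 hθ1 hbs hta hts htf hprof hG hGc h2e' hs1 hs2 hs4 hs5 he hW hWM hτ0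
  have hsmall : ∀ᶠ ee in 𝓝 e, |1 / ee ^ 2 - 1 / e ^ 2| < min (3 * ρ / (16 * e' ^ 3)) τ := by
    have h := invSq_sub_invSq_tendsto_zero he.1.ne'
    have hpos : 0 < min (3 * ρ / (16 * e' ^ 3)) τ := by positivity
    have := (Metric.tendsto_nhds.1 h) _ hpos
    refine this.mono fun ee hee => ?_
    rwa [Real.dist_eq, sub_zero] at hee
  filter_upwards [self_mem_nhdsWithin, hslope, hjac, eventually_nhdsWithin_of_eventually_nhds hcont, eventually_nhdsWithin_of_eventually_nhds hsmall]
    with ee hne' hsl hja hco hsm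
  obtain ⟨hee, hsl⟩ := hsl
  obtain ⟨-, hja⟩ := hja
  obtain ⟨-, hco⟩ := hco
  refine ⟨hee, fun WW hWW hWWM k => ?_⟩
  have hsm1 : |1 / ee ^ 2 - 1 / e ^ 2| < 3 * ρ / (16 * e' ^ 3) := hsm.trans_le (min_le_left _ _)
  have hsm2 : |1 / ee ^ 2 - 1 / e ^ 2| ≤ τ := (hsm.trans_le (min_le_right _ _)).le
  have hρ' : 16 / 3 * e' ^ 3 * |1 / ee ^ 2 - 1 / e ^ 2| ≤ ρ := by
    have := (lt_div_iff₀ (by positivity : (0:ℝ) < 16 * e' ^ 3)).mp hsm1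
    linarith
  have hηW' : ∀ q, |WW q - W q| ≤ τ := hco WW hWW hWWM
  have hmain := secondQuotient_sub_secondTangent_abs_le hB hCm hθ0 hθ1 hbs hta hts htf hprof hG hCH hH hτ0.le hrem2 h2e' hs1 hs2 hs4 hs5 hec hee hne' hρ'
    hW hWM hWW hWWM hV hVM hτ0.le hsl hτ0.le hja hτ0.le hηW' k
  have hform : ((((8 * e' ^ 3 / (1 - θ) * (2 / 3 * τ + CH * τ)) / 2 + (8 * CH * e' ^ 3 / (1 - θ)) * (4 * e' ^ 2 * |1 / ee ^ 2 - 1 / e ^ 2|) + Cm * τ) * 2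
            + ((8 * CH * e' ^ 3 / (1 - θ)) / 2 + Cm * (6 * e' ^ 2)) * τ) * (8 * e' ^ 3 + 16 * e' / bs) * 1 / (1 - θ))
        / (1 - Cm * (8 * e' ^ 3 + 16 * e' / bs) / (2 * (1 - θ)))
      = L * (8 * e' ^ 3 / (1 - θ) * (2 / 3) * τ + 8 * e' ^ 3 / (1 - θ) * CH * τ + 2 * (8 * CH * e' ^ 3 / (1 - θ)) * (4 * e' ^ 2) * |1 / ee ^ 2 - 1 / e ^ 2|
          + 2 * Cm * τ + ((8 * CH * e' ^ 3 / (1 - θ)) / 2 + Cm * (6 * e' ^ 2)) * τ) := by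
    rw [hL]; ring
  have hδτ : 2 * (8 * CH * e' ^ 3 / (1 - θ)) * (4 * e' ^ 2) * |1 / ee ^ 2 - 1 / e ^ 2| ≤ 2 * (8 * CH * e' ^ 3 / (1 - θ)) * (4 * e' ^ 2) * τ :=
    mul_le_mul_of_nonneg_left hsm2 (by positivity)
  have hsum : 8 * e' ^ 3 / (1 - θ) * (2 / 3) * τ + 8 * e' ^ 3 / (1 - θ) * CH * τ + 2 * (8 * CH * e' ^ 3 / (1 - θ)) * (4 * e' ^ 2) * |1 / ee ^ 2 - 1 / e ^ 2|
        + 2 * Cm * τ + ((8 * CH * e' ^ 3 / (1 - θ)) / 2 + Cm * (6 * e' ^ 2)) * τ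
      ≤ (8 * e' ^ 3 / (1 - θ) * (2 / 3) + 8 * e' ^ 3 / (1 - θ) * CH + 2 * (8 * CH * e' ^ 3 / (1 - θ)) * (4 * e' ^ 2)
          + 2 * Cm + ((8 * CH * e' ^ 3 / (1 - θ)) / 2 + Cm * (6 * e' ^ 2))) * τ := by
    have e1 : (8 * e' ^ 3 / (1 - θ) * (2 / 3) + 8 * e' ^ 3 / (1 - θ) * CH + 2 * (8 * CH * e' ^ 3 / (1 - θ)) * (4 * e' ^ 2)
          + 2 * Cm + ((8 * CH * e' ^ 3 / (1 - θ)) / 2 + Cm * (6 * e' ^ 2))) * τ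
        = 8 * e' ^ 3 / (1 - θ) * (2 / 3) * τ + 8 * e' ^ 3 / (1 - θ) * CH * τ + 2 * (8 * CH * e' ^ 3 / (1 - θ)) * (4 * e' ^ 2) * τ
          + 2 * Cm * τ + ((8 * CH * e' ^ 3 / (1 - θ)) / 2 + Cm * (6 * e' ^ 2)) * τ := by ring
    rw [e1]
    exact add_le_add (add_le_add (add_le_add (add_le_add le_rfl le_rfl) hδτ) le_rfl) le_rfl
  have hfin : M * τ ≤ ε₀ := by rw [hτ]; exact mul_div_succ_le hM0 hε₀.le
  calc _ ≤ _ := hmain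
    _ = _ := hform
    _ ≤ L * ((8 * e' ^ 3 / (1 - θ) * (2 / 3) + 8 * e' ^ 3 / (1 - θ) * CH + 2 * (8 * CH * e' ^ 3 / (1 - θ)) * (4 * e' ^ 2)
          + 2 * Cm + ((8 * CH * e' ^ 3 / (1 - θ)) / 2 + Cm * (6 * e' ^ 2))) * τ) := mul_le_mul_of_nonneg_left hsum hL0
    _ = M * τ := by rw [hM]; ring
    _ ≤ ε₀ := hfin

end

end Summit.QuantumFields.BalabanUV.Beta.EriceFlowEnclosureB12AsPrintedHistoryContagionShiftFlowZeroTangentSecondFlow
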